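import Literature.NumberTheory.Automorphic.RamakrishnanTensorProductGL2
import Literature.NumberTheory.Automorphic.AutomorphicRepsGLSatakeFlathProofs
import Literature.NumberTheory.Automorphic.GLnAdelicStructureProofs
import Literature.NumberTheory.Automorphic.SatakeParamNeZeroProofs
import Literature.NumberTheory.GaloisRepresentations.HeckeCharacterWeakApproximation
import HarnessLib

/-!
# Ramakrishnan (2000), Theorem 4.1.2: the printed proof mapped onto the tree (proved reductions)

Topic `NumberTheory/Automorphic`; namespace `Literature.NumberTheory.Automorphic`. Sibling proof
file of `RamakrishnanTensorProductGL2`, working towards the discharge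
`Ramakrishnan2000_multiplicityOneSL2_holds` of the named fact
`Ramakrishnan2000_multiplicityOneSL2` (D. Ramakrishnan, *Modularity of the Rankin–Selberg
`L`-series, and multiplicity one for `SL(2)`*, Ann. of Math. 152 (2000), 45–111, Thm. 4.1.2).
Theorems only; no definition, no named fact, no `sorry`.

## The printed proof (op. cit. §4.1, pp. 37–39) and what is proved here

Let `π, π'` be cuspidal on `GL(2)/F` with `(LL(v))` `Ad(π_v) ≃ Ad(π'_v)` for almost all `v` — in
the tree's rendering: for almost all `v` the Satake parameter of `π'` at `v` is `c_v · t_{π,v}`,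
`c_v ≠ 0` (the hypothesis of `Ramakrishnan2000_multiplicityOneSL2`).

1. *Dihedral vs. non-dihedral.* The printed proof first shows that `π` is dihedral iff `π'` is
   (p. 38: "`L(s, Ad(π) ⊗ δ)` has a pole at `s = 1`. This forces `π'` also to be dihedral, for
   otherwise `L(s, Ad(π') ⊗ δ)` will be entire ([GJ])"). In the Satake rendering of "dihedral"
   used by `Ramakrishnan2000_theoremM` (`IsSatakeSelfTwist`: a self-twist `t_{π,v} = δ(ϖ_v) t_{π,v}`
   a.e. by a Hecke character `δ ≠ 1`) this step is elementary and is **proved here** without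
   `L`-functions: under `(LL(v))`, `t_{π',v} = c_v t_{π,v}` and `t_{π',v} = δ(ϖ_v) t_{π',v}` give
   `t_{π,v} = δ(ϖ_v) t_{π,v}` by cancelling `c_v`, using only the uniqueness of Satake parameters
   (`AutomorphicRepData.hasSatakeParamAt_unique_holds`, proved in `AutomorphicRepsGLSatakeFlathProofs`):
   `isSatakeTwistBy_self_of_LL_left`, `isSatakeTwistBy_self_of_LL_right`,
   `isSatakeSelfTwist_iff_of_LL`.
2. *Non-dihedral case* (p. 39): `Π = π ⊠ π'` exists (Theorem M); **Lemma 4.1.4**: `Π` is not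
   cuspidal (Jacquet–Shalika: `L^S(s, Π × Π^∨)` would have a simple pole at `s = 1`, but
   `(Id) L^S(s, Π × Π^∨) = ζ_F^S(s) L^S(s, Ad π) L^S(s, Ad π') L^S(s, Ad π × Ad π')` has a double pole,
   `Ad π ≅ Ad π'` being selfdual and cuspidal on `GL(3)` by Gelbart–Jacquet); then "by the cuspidality
   criterion of Theorem M … `π'` must be isomorphic to `π ⊗ χ`". **Proved here**: the last step,
   `Ramakrishnan2000_multiplicityOneSL2.nonDihedral_of_theoremM` (criterion (ii) of
   `Ramakrishnan2000_theoremM` applied to the non-existence of a cuspidal `Π` on `GL(4)` with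
   Satake parameters `{αᵢ βⱼ}`, the tree's rendering of "`π ⊠ π'` is not cuspidal").
3. *Assembly*, `Ramakrishnan2000_multiplicityOneSL2.of_theoremM`: the named fact follows from
   (a) `Ramakrishnan2000_theoremM`, (b) Lemma 4.1.4 in the tree's rendering and (c) the conclusion
   in the both-dihedral case, with the case split of step 1 supplied by `isSatakeSelfTwist_iff_of_LL`
   and the `GL(4)` level-compactness input of Theorem M by `isCompact_glFiniteIntegralLevel_holds`.
4. *The secondary clauses of Thm. 4.1.2*, proved outright at the level of Satake parameters (they
   are not part of the named fact, see the docstring of `Ramakrishnan2000_multiplicityOneSL2`):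
   "`χ` is unique if `π` is not automorphically induced by a character of a quadratic extension" —
   `IsSatakeTwistBy.unique_of_not_isSatakeSelfTwist` (two twisting characters `χ₁, χ₂` give the
   self-twist `χ₁ χ₂⁻¹` of `π`; `IsSatakeTwistBy.trans`, `IsSatakeTwistBy.symm_inv`), and "if `π` and
   `π'` have the same central character, then `χ` is quadratic" —
   `IsSatakeTwistBy.pow_eq_one_of_eventually_prod_eq` (`det t_{π',v} = χ(ϖ_v)^n det t_{π,v}` with
   `det t_{π,v} ≠ 0`, `hasSatakeParamAt_ne_zero_holds`, so `χ(ϖ_v)^n = 1` a.e. and `χ^n = 1` by the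
   rigidity of Hecke characters, `HeckeCharacter.eq_one_of_eventually_valueAtUniformizer_eq_one`);
   in particular a self-twisting character of a `GL(n)` datum has order dividing `n`
   (`IsSatakeTwistBy.pow_eq_one_of_self`, `IsSatakeSelfTwist.exists_pow_eq_one`: on `GL(2)` a
   non-trivial self-twist is quadratic, as asserted in the docstring of `IsSatakeSelfTwist`). Granting
   the named fact these give Thm. 4.1.2 with its two clauses:
   `Ramakrishnan2000_multiplicityOneSL2.existsUnique`, `Ramakrishnan2000_multiplicityOneSL2.quadratic`.

## What remains for `Ramakrishnan2000_multiplicityOneSL2_holds` (not in this file)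

(a) is the unproved named fact `Ramakrishnan2000_theoremM` (the main theorem of op. cit.);
(b) needs the Jacquet–Shalika pole/boundary statements for Borel–Jacquet data
(`JacquetShalika1981_partialPairL_pole_repData`, `JacquetShalika1981_partialPairL_boundary_repData`
of `PairLFunctionPolesRepData`, named facts) on `GL(4) × GL(4)`, `GL(3) × GL(3)`, `GL(3) × GL(1)` and
the Gelbart–Jacquet lift (`GelbartJacquet_adjoint_lift` of `LanglandsTetrahedral`, named fact);
(c) is the printed dihedral analysis (p. 38: `π = I_K^F(μ)`, `π' = I_K^F(μ')`, base change of
`Ad(π) = Ad(π')` to `K`, `μ' = μ χ_K`), which needs automorphic induction from quadratic `K` and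
op. cit. Prop. 2.3.1 (2), absent from the tree in proved form.

## References

* D. Ramakrishnan, *Modularity of the Rankin–Selberg `L`-series, and multiplicity one for `SL(2)`*,
  Ann. of Math. (2) 152 (2000), 45–111; Theorem M (§3, p. 9), Prop. 3.2.1 (pp. 14–15), Thm. 4.1.2
  and its proof, Lemma 4.1.4 (§4.1, pp. 37–39). [Ramakrishnan2000]
* D. Flath, *Decomposition of representations into tensor products*, Corvallis (1979), Thm. 3
  (uniqueness of Satake parameters, via `AutomorphicRepsGLSatakeFlathProofs`). [FlathCorvallis1979]
* J. W. S. Cassels, A. Fröhlich (eds.), *Algebraic Number Theory* (1967), Ch. VII §4, Prop. 4.1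
  (a Hecke character is determined by its values at almost all uniformizers, via
  `HeckeCharacterWeakApproximation`). [CasselsFrohlichANT1967]
* P. Cartier, *Representations of `p`-adic groups*, Corvallis (1979), §IV.2 (Satake parameters are
  non-zero, via `SatakeParamNeZeroProofs`). [CartierCorvallis1979]
-/

noncomputable section

open scoped MatrixGroups Classical
open NumberField IsDedekindDomain

namespace Literature.NumberTheory.Automorphic

/-! ### Cancelling a non-zero scalar in a twist relation of multisets -/

/-- If `{c x} = {d c x}` (as multisets) with `c ≠ 0`, then `{d x} = {x}`. [folklore] -/
theorem multiset_map_mul_eq_self_of_map_mul_eq {α : Multiset ℂ} {c d : ℂ} (hc : c ≠ 0)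
    (h : (α.map (c * ·)).map (d * ·) = α.map (c * ·)) : α.map (d * ·) = α := by
  have h' := congrArg (Multiset.map (c⁻¹ * ·)) h
  simp only [Multiset.map_map, Function.comp_def] at h'
  have h1 : (fun x => c⁻¹ * (d * (c * x))) = (d * ·) := funext fun x => by
    field_simp
  have h2 : (fun x => c⁻¹ * (c * x)) = id := funext fun x => by
    rw [← mul_assoc, inv_mul_cancel₀ hc, one_mul]; rfl
  rwa [h1, h2, Multiset.map_id] at h'

/-- Twisting commutes with scaling: `{d (c x)} = {c (d x)}`. [folklore] -/
theorem multiset_map_mul_map_mul_comm (α : Multiset ℂ) (c d : ℂ) :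
    (α.map (c * ·)).map (d * ·) = (α.map (d * ·)).map (c * ·) := by
  simp only [Multiset.map_map, Function.comp_def]
  exact Multiset.map_congr rfl fun x _ => by ring

/-! ### Step 1 of the printed proof: under `(LL)`, `π` is dihedral iff `π'` is -/

section SelfTwist

variable {n : ℕ} {F : Type} [Field F] [NumberField F] {hF : isCompact_glFiniteIntegralLevel n F}

/-- **Self-twists transfer along `(LL)`, from `π'` to `π`.** If for almost all `v` the Satake
parameter of `π'` at `v` is `c_v · t_{π,v}` with `c_v ≠ 0` (the hypothesis `(LL(v))`,
`Ad(π_v) ≃ Ad(π'_v)`, of op. cit. Thm. 4.1.2 in the tree's rendering) and `π' ≃ π' ⊗ δ` at the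
level of Satake parameters a.e. (`IsSatakeTwistBy π' π' δ`), then `π ≃ π ⊗ δ` likewise:
`t_{π',v} = δ(ϖ_v) t_{π',v} = δ(ϖ_v) c_v t_{π,v}` and `t_{π',v} = c_v t_{π,v}`, cancel `c_v`
(uniqueness of Satake parameters, Flath). This is the Satake-level form of the step "`π'`
dihedral forces `π` dihedral" of the printed proof (op. cit. p. 38, there via the pole of
`L(s, Ad(π) ⊗ δ)` and [GJ]). [cite: Ramakrishnan2000, §4.1, proof of Thm. 4.1.2 (p. 38)] -/
theorem isSatakeTwistBy_self_of_LL_left (π π' : AutomorphicRepData (AutomorphyDatum.gl n F hF))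
    (hLL : ∀ᶠ v : HeightOneSpectrum (𝓞 F) in Filter.cofinite, ∃ (α : Multiset ℂ) (c : ℂ), c ≠ 0 ∧
      π.HasSatakeParamAt v α ∧ π'.HasSatakeParamAt v (α.map (c * ·)))
    {δ : GaloisRepresentations.HeckeCharacter F} (hδ : IsSatakeTwistBy π' π' δ) :
    IsSatakeTwistBy π π δ := by
  refine (hLL.and hδ).mono fun v hv α hα => ?_
  obtain ⟨⟨α₀, c, hc, hα₀, hα₀'⟩, hv'⟩ := hv
  obtain rfl : α = α₀ := π.hasSatakeParamAt_unique_holds hα hα₀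
  have h1 := hv' _ hα₀'
  have h2 : ((α.map (c * ·)).map (δ.valueAtUniformizer v * ·)) = α.map (c * ·) :=
    π'.hasSatakeParamAt_unique_holds h1 hα₀'
  rwa [multiset_map_mul_eq_self_of_map_mul_eq hc h2]

/-- **Self-twists transfer along `(LL)`, from `π` to `π'`** (the symmetric statement: with
`t_{π',v} = c_v t_{π,v}` and `t_{π,v} = δ(ϖ_v) t_{π,v}`, `δ(ϖ_v) t_{π',v} = c_v δ(ϖ_v) t_{π,v} =
c_v t_{π,v} = t_{π',v}`). [cite: Ramakrishnan2000, §4.1, proof of Thm. 4.1.2 (p. 38)] -/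
theorem isSatakeTwistBy_self_of_LL_right (π π' : AutomorphicRepData (AutomorphyDatum.gl n F hF))
    (hLL : ∀ᶠ v : HeightOneSpectrum (𝓞 F) in Filter.cofinite, ∃ (α : Multiset ℂ) (c : ℂ), c ≠ 0 ∧
      π.HasSatakeParamAt v α ∧ π'.HasSatakeParamAt v (α.map (c * ·)))
    {δ : GaloisRepresentations.HeckeCharacter F} (hδ : IsSatakeTwistBy π π δ) :
    IsSatakeTwistBy π' π' δ := by
  refine (hLL.and hδ).mono fun v hv β hβ => ?_
  obtain ⟨⟨α₀, c, _hc, hα₀, hα₀'⟩, hv'⟩ := hv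
  obtain rfl : β = α₀.map (c * ·) := π'.hasSatakeParamAt_unique_holds hβ hα₀'
  have h1 : α₀.map (δ.valueAtUniformizer v * ·) = α₀ :=
    π.hasSatakeParamAt_unique_holds (hv' _ hα₀) hα₀
  rwa [multiset_map_mul_map_mul_comm, h1]

/-- **Under `(LL)`, `π` is dihedral iff `π'` is** ("dihedral" rendered as `IsSatakeSelfTwist`, as in
`Ramakrishnan2000_theoremM`): the case split of the printed proof of Thm. 4.1.2
(op. cit. p. 38). [cite: Ramakrishnan2000, §4.1, proof of Thm. 4.1.2 (p. 38)] -/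
theorem isSatakeSelfTwist_iff_of_LL (π π' : AutomorphicRepData (AutomorphyDatum.gl n F hF))
    (hLL : ∀ᶠ v : HeightOneSpectrum (𝓞 F) in Filter.cofinite, ∃ (α : Multiset ℂ) (c : ℂ), c ≠ 0 ∧
      π.HasSatakeParamAt v α ∧ π'.HasSatakeParamAt v (α.map (c * ·))) :
    IsSatakeSelfTwist π ↔ IsSatakeSelfTwist π' :=
  ⟨fun ⟨δ, hδ1, hδ⟩ => ⟨δ, hδ1, isSatakeTwistBy_self_of_LL_right π π' hLL hδ⟩,
    fun ⟨δ, hδ1, hδ⟩ => ⟨δ, hδ1, isSatakeTwistBy_self_of_LL_left π π' hLL hδ⟩⟩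

end SelfTwist

/-! ### Step 2: the non-dihedral case from Theorem M and Lemma 4.1.4 -/

section NonDihedral

variable {F : Type} [Field F] [NumberField F]

/-- **The non-dihedral case of Thm. 4.1.2 from the cuspidality criterion** (op. cit. p. 39:
"Thus `π, π'` are non-dihedral cusp forms on `GL(2)/F` with `π ⊠ π'` not cuspidal. Then by the
cuspidality criterion of Theorem M …, we see that `π'` must be isomorphic to `π ⊗ χ` for an idele
class character `χ`"). Granting `Ramakrishnan2000_theoremM`: if neither `π` nor `π'` admits a
non-trivial self-twist and no cuspidal `Π` on `GL(4)/F` has the Satake parameters `{αᵢ βⱼ}` at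
almost all places (the tree's rendering of Lemma 4.1.4, "`π ⊠ π'` is not cuspidal"), then `π'` is a
twist of `π` by a Hecke character at the level of Satake parameters a.e.
[cite: Ramakrishnan2000, Theorem M and §4.1, Lemma 4.1.4] -/
theorem Ramakrishnan2000_multiplicityOneSL2.nonDihedral_of_theoremM (hM : Ramakrishnan2000_theoremM)
    (h2 : isCompact_glFiniteIntegralLevel 2 F) (h4 : isCompact_glFiniteIntegralLevel 4 F)
    (π π' : CuspidalAutomorphicRepData 2 F h2) (hπ : ¬ IsSatakeSelfTwist π.1)
    (hπ' : ¬ IsSatakeSelfTwist π'.1)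
    (h414 : ¬ ∃ P : CuspidalAutomorphicRepData 4 F h4,
      ∀ᶠ v : HeightOneSpectrum (𝓞 F) in Filter.cofinite, ∀ α β : Multiset ℂ,
        π.1.HasSatakeParamAt v α → π'.1.HasSatakeParamAt v β →
          P.1.HasSatakeParamAt v (satakeTensor α β)) :
    ∃ χ : GaloisRepresentations.HeckeCharacter F, IsSatakeTwistBy π.1 π'.1 χ := by
  by_contra hC
  exact h414 (((hM F h2 h4 π π').2 hπ hπ').mpr hC)

end NonDihedral

/-! ### Step 3: assembly -/

/-- **Thm. 4.1.2 from Theorem M, Lemma 4.1.4 and the dihedral case** — the architecture of the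
printed proof (op. cit. §4.1, pp. 37–39) in the tree's rendering. `Ramakrishnan2000_multiplicityOneSL2`
follows from: (a) `Ramakrishnan2000_theoremM`; (b) Lemma 4.1.4 — for cuspidal `π, π'` on `GL(2)/F`
satisfying `(LL)` and admitting no non-trivial self-twist, no cuspidal `Π` on `GL(4)/F` has Satake
parameters `{αᵢ βⱼ}` a.e. (printed proof: Jacquet–Shalika poles of `L^S(s, Π × Π^∨)` and the
identity `(Id)`, with Gelbart–Jacquet); (c) the conclusion in the case where both `π` and `π'` admit
a non-trivial self-twist (printed proof: `π = I_K^F(μ)`, `π' = I_K^F(μ')`, `μ' = μ χ_K`). The mixed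
cases do not occur (`isSatakeSelfTwist_iff_of_LL`), and the `GL(4)` level input of (a) is
`isCompact_glFiniteIntegralLevel_holds`. [cite: Ramakrishnan2000, §4.1, proof of Thm. 4.1.2] -/
theorem Ramakrishnan2000_multiplicityOneSL2.of_theoremM (hM : Ramakrishnan2000_theoremM)
    (h414 : ∀ (F : Type) [Field F] [NumberField F] (h2 : isCompact_glFiniteIntegralLevel 2 F)
      (h4 : isCompact_glFiniteIntegralLevel 4 F) (π π' : CuspidalAutomorphicRepData 2 F h2),
      (∀ᶠ v : HeightOneSpectrum (𝓞 F) in Filter.cofinite, ∃ (α : Multiset ℂ) (c : ℂ), c ≠ 0 ∧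
        π.1.HasSatakeParamAt v α ∧ π'.1.HasSatakeParamAt v (α.map (c * ·))) →
      ¬ IsSatakeSelfTwist π.1 → ¬ IsSatakeSelfTwist π'.1 →
      ¬ ∃ P : CuspidalAutomorphicRepData 4 F h4,
        ∀ᶠ v : HeightOneSpectrum (𝓞 F) in Filter.cofinite, ∀ α β : Multiset ℂ,
          π.1.HasSatakeParamAt v α → π'.1.HasSatakeParamAt v β →
            P.1.HasSatakeParamAt v (satakeTensor α β))
    (hdih : ∀ (F : Type) [Field F] [NumberField F] (h2 : isCompact_glFiniteIntegralLevel 2 F)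
      (π π' : CuspidalAutomorphicRepData 2 F h2),
      (∀ᶠ v : HeightOneSpectrum (𝓞 F) in Filter.cofinite, ∃ (α : Multiset ℂ) (c : ℂ), c ≠ 0 ∧
        π.1.HasSatakeParamAt v α ∧ π'.1.HasSatakeParamAt v (α.map (c * ·))) →
      IsSatakeSelfTwist π.1 → IsSatakeSelfTwist π'.1 →
      ∃ χ : GaloisRepresentations.HeckeCharacter F, IsSatakeTwistBy π.1 π'.1 χ) :
    Ramakrishnan2000_multiplicityOneSL2 := by
  intro F _ _ h2 π π' hLL
  by_cases hπ : IsSatakeSelfTwist π.1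
  · exact hdih F h2 π π' hLL hπ ((isSatakeSelfTwist_iff_of_LL π.1 π'.1 hLL).mp hπ)
  · have hπ' : ¬ IsSatakeSelfTwist π'.1 := fun h => hπ ((isSatakeSelfTwist_iff_of_LL π.1 π'.1 hLL).mpr h)
    have h4 := isCompact_glFiniteIntegralLevel_holds 4 F
    exact Ramakrishnan2000_multiplicityOneSL2.nonDihedral_of_theoremM hM h2 h4 π π' hπ hπ'
      (h414 F h2 h4 π π' hLL hπ hπ')

/-! ### Step 4: the secondary clauses of Thm. 4.1.2 — uniqueness of `χ`, and `χ` quadratic -/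

section Clauses

variable {n : ℕ} {F : Type} [Field F] [NumberField F] {hF : isCompact_glFiniteIntegralLevel n F}

/-- `(χ₁ χ₂)(ϖ_v) = χ₁(ϖ_v) χ₂(ϖ_v)`. [folklore] -/
private theorem valueAtUniformizer_mul_eq (χ₁ χ₂ : GaloisRepresentations.HeckeCharacter F)
    (v : HeightOneSpectrum (𝓞 F)) :
    (χ₁ * χ₂).valueAtUniformizer v = χ₁.valueAtUniformizer v * χ₂.valueAtUniformizer v := by
  simp only [GaloisRepresentations.HeckeCharacter.valueAtUniformizer,
    GaloisRepresentations.HeckeCharacter.localComponent_apply,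
    GaloisRepresentations.HeckeCharacter.mul_apply, Units.val_mul]

/-- `χ⁻¹(ϖ_v) = χ(ϖ_v)⁻¹`. [folklore] -/
private theorem valueAtUniformizer_inv_eq (χ : GaloisRepresentations.HeckeCharacter F)
    (v : HeightOneSpectrum (𝓞 F)) :
    χ⁻¹.valueAtUniformizer v = (χ.valueAtUniformizer v)⁻¹ := by
  simp only [GaloisRepresentations.HeckeCharacter.valueAtUniformizer,
    GaloisRepresentations.HeckeCharacter.localComponent_apply,
    GaloisRepresentations.HeckeCharacter.inv_apply, Units.val_inv_eq_inv_val]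

/-- `χᵏ(ϖ_v) = χ(ϖ_v)ᵏ`. [folklore] -/
private theorem valueAtUniformizer_pow_eq (χ : GaloisRepresentations.HeckeCharacter F) (k : ℕ)
    (v : HeightOneSpectrum (𝓞 F)) :
    (χ ^ k).valueAtUniformizer v = χ.valueAtUniformizer v ^ k := by
  simp only [GaloisRepresentations.HeckeCharacter.valueAtUniformizer,
    GaloisRepresentations.HeckeCharacter.localComponent_apply,
    GaloisRepresentations.HeckeCharacter.pow_apply, Units.val_pow_eq_pow_val]

/-- `χ(ϖ_v) ≠ 0`. [folklore] -/
private theorem valueAtUniformizer_ne_zero' (χ : GaloisRepresentations.HeckeCharacter F)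
    (v : HeightOneSpectrum (𝓞 F)) : χ.valueAtUniformizer v ≠ 0 := by
  simp only [GaloisRepresentations.HeckeCharacter.valueAtUniformizer]
  exact Units.ne_zero _

/-- `∏ (c αᵢ) = c ^ n ∏ αᵢ` for an `n`-element multiset `α`. [folklore] -/
private theorem prod_map_const_mul (α : Multiset ℂ) (c : ℂ) :
    (α.map (c * ·)).prod = c ^ Multiset.card α * α.prod := by
  induction α using Multiset.induction_on with
  | empty => simp
  | cons a s ih =>
    rw [Multiset.map_cons, Multiset.prod_cons, ih, Multiset.card_cons, pow_succ, Multiset.prod_cons]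
    ring

/-- **Satake twists compose**: if `t_{π',v} = χ₁(ϖ_v) t_{π,v}` and `t_{π'',v} = χ₂(ϖ_v) t_{π',v}`
almost everywhere, then `t_{π'',v} = (χ₁ χ₂)(ϖ_v) t_{π,v}` almost everywhere
(`(π ⊗ χ₁) ⊗ χ₂ ≃ π ⊗ χ₁χ₂` on Satake parameters). [folklore] -/
theorem IsSatakeTwistBy.trans {π π' π'' : AutomorphicRepData (AutomorphyDatum.gl n F hF)}
    {χ₁ χ₂ : GaloisRepresentations.HeckeCharacter F} (h₁ : IsSatakeTwistBy π π' χ₁)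
    (h₂ : IsSatakeTwistBy π' π'' χ₂) : IsSatakeTwistBy π π'' (χ₁ * χ₂) := by
  filter_upwards [h₁, h₂] with v hv₁ hv₂ α hα
  have e : α.map ((χ₁ * χ₂).valueAtUniformizer v * ·) =
      (α.map (χ₁.valueAtUniformizer v * ·)).map (χ₂.valueAtUniformizer v * ·) := by
    rw [Multiset.map_map]
    refine Multiset.map_congr rfl fun x _ => ?_
    simp only [Function.comp_apply, valueAtUniformizer_mul_eq]
    ring
  rw [e]
  exact hv₂ _ (hv₁ α hα)

/-- **Satake twists invert**: if `t_{π',v} = χ(ϖ_v) t_{π,v}` almost everywhere, then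
`t_{π,v} = χ⁻¹(ϖ_v) t_{π',v}` almost everywhere (`π' ≃ π ⊗ χ ⇒ π ≃ π' ⊗ χ⁻¹` on Satake parameters)
— using that `π` is unramified at almost every place and that the Satake parameter of `π'` at a
place is unique (Flath 1979, Thm. 3; proved in the tree,
`AutomorphicRepData.hasSatakeParamAt_cofinite_holds`, `hasSatakeParamAt_unique_holds`).
[cite: FlathCorvallis1979, Thm. 3] -/
theorem IsSatakeTwistBy.symm_inv {π π' : AutomorphicRepData (AutomorphyDatum.gl n F hF)}
    {χ : GaloisRepresentations.HeckeCharacter F} (h : IsSatakeTwistBy π π' χ) :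
    IsSatakeTwistBy π' π χ⁻¹ := by
  filter_upwards [h, π.hasSatakeParamAt_cofinite_holds] with v hv hur β hβ
  obtain ⟨α, hα⟩ := hur
  obtain rfl : β = α.map (χ.valueAtUniformizer v * ·) :=
    π'.hasSatakeParamAt_unique_holds hβ (hv α hα)
  have e : (α.map (χ.valueAtUniformizer v * ·)).map (χ⁻¹.valueAtUniformizer v * ·) = α := by
    rw [Multiset.map_map]
    conv_rhs => rw [← Multiset.map_id α]
    refine Multiset.map_congr rfl fun x _ => ?_
    simp only [Function.comp_apply, valueAtUniformizer_inv_eq, id]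
    rw [← mul_assoc, inv_mul_cancel₀ (valueAtUniformizer_ne_zero' χ v), one_mul]
  rw [e]
  exact hα

/-- **The uniqueness clause of Thm. 4.1.2** (op. cit.: "there exists an idele class character `χ`,
which is unique if `π` is not automorphically induced by a character of a quadratic extension,
such that `π' ≃ π ⊗ χ`"), at the level of Satake parameters and unconditionally: if `π` admits no
non-trivial self-twist (`¬ IsSatakeSelfTwist π`, the rendering of "`π` is not dihedral" through
op. cit. Prop. 2.3.1 (2)), then at most one Hecke character twists `π` to `π'` almost everywhere —
two such characters `χ₁, χ₂` give the self-twist `χ₁ χ₂⁻¹` of `π` (`trans`, `symm_inv`), which must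
be trivial. [cite: Ramakrishnan2000, Theorem 4.1.2] -/
theorem IsSatakeTwistBy.unique_of_not_isSatakeSelfTwist
    {π π' : AutomorphicRepData (AutomorphyDatum.gl n F hF)}
    {χ₁ χ₂ : GaloisRepresentations.HeckeCharacter F} (h₁ : IsSatakeTwistBy π π' χ₁)
    (hπ : ¬ IsSatakeSelfTwist π) (h₂ : IsSatakeTwistBy π π' χ₂) : χ₁ = χ₂ := by
  by_contra hne
  exact hπ ⟨χ₁ * χ₂⁻¹, fun h1 => hne (mul_inv_eq_one.1 h1), h₁.trans h₂.symm_inv⟩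

/-- **The twisting character has order dividing `n` when the central characters agree** — for
`n = 2` the clause "If `π` and `π'` have the same central character, then `χ` is quadratic" of
Thm. 4.1.2 — at the level of Satake parameters and unconditionally: if `t_{π',v} = χ(ϖ_v) t_{π,v}`
a.e. and `det t_{π,v} = det t_{π',v}` a.e. (the unramified shadow of `ω_π = ω_{π'}`:
`ω_π(ϖ_v) = e_n(t_{π,v}) = det t_{π,v}` at an unramified `v`), then, `π` being unramified at almost
every `v` (`hasSatakeParamAt_cofinite_holds`) with `n` non-zero Satake parameters
(`HasSatakeParamAt.card_eq`, `hasSatakeParamAt_ne_zero_holds`, Cartier §IV.2),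
`det t_{π,v} = χ(ϖ_v)^n det t_{π,v} ≠ 0` gives `χ^n(ϖ_v) = 1` a.e., whence `χ ^ n = 1` (a Hecke
character with value `1` at almost all uniformizers is trivial: Cassels–Fröhlich VII §4, Prop. 4.1,
`HeckeCharacter.eq_one_of_eventually_valueAtUniformizer_eq_one`).
[cite: Ramakrishnan2000, Theorem 4.1.2] [cite: CasselsFrohlichANT1967, Ch. VII §4 Prop. 4.1 (proof)] -/
theorem IsSatakeTwistBy.pow_eq_one_of_eventually_prod_eq
    {π π' : AutomorphicRepData (AutomorphyDatum.gl n F hF)}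
    {χ : GaloisRepresentations.HeckeCharacter F} (h : IsSatakeTwistBy π π' χ)
    (hω : ∀ᶠ v : HeightOneSpectrum (𝓞 F) in Filter.cofinite, ∀ α β : Multiset ℂ,
      π.HasSatakeParamAt v α → π'.HasSatakeParamAt v β → α.prod = β.prod) :
    χ ^ n = 1 := by
  refine GaloisRepresentations.HeckeCharacter.eq_one_of_eventually_valueAtUniformizer_eq_one ?_
  filter_upwards [h, hω, π.hasSatakeParamAt_cofinite_holds] with v hv hωv hur
  obtain ⟨α, hα⟩ := hur
  have hprod : α.prod ≠ 0 :=
    Multiset.prod_ne_zero fun h0 => hasSatakeParamAt_ne_zero_holds hα 0 h0 rfl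
  have key := hωv α _ hα (hv α hα)
  rw [prod_map_const_mul, hα.card_eq] at key
  rw [valueAtUniformizer_pow_eq]
  exact (mul_eq_right₀ hprod).1 key.symm

/-- **A self-twisting character of a `GL(n)` datum has order dividing `n`**: if
`t_{π,v} = δ(ϖ_v) t_{π,v}` a.e. then `δ ^ n = 1` (the case `π' = π` of
`pow_eq_one_of_eventually_prod_eq`, the determinant condition holding by the uniqueness of Satake
parameters). On `GL(2)`: a non-trivial self-twist `δ` is quadratic — "a self-twisting `δ ≠ 1` of a
cuspidal `π` on `GL(2)` is quadratic, `ω_π = ω_π δ²`, hence of the form `χ_{K/F}`" (docstring of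
`IsSatakeSelfTwist`; Ramakrishnan 2000, Prop. 2.3.1 (2)). [cite: Ramakrishnan2000, Prop. 2.3.1 (2)] -/
theorem IsSatakeTwistBy.pow_eq_one_of_self {π : AutomorphicRepData (AutomorphyDatum.gl n F hF)}
    {δ : GaloisRepresentations.HeckeCharacter F} (h : IsSatakeTwistBy π π δ) : δ ^ n = 1 :=
  h.pow_eq_one_of_eventually_prod_eq
    (Filter.Eventually.of_forall fun _ α β hα hβ => by rw [π.hasSatakeParamAt_unique_holds hα hβ])

/-- **"Dihedral" data have a self-twist of order dividing `n`** (`n = 2`: by a quadratic character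
`δ ≠ 1`, i.e. `δ = χ_{K/F}` for a quadratic extension `K/F` by class field theory — the form in
which op. cit. Prop. 2.3.1 (2) characterises the image of automorphic induction `I_K^F`).
[cite: Ramakrishnan2000, Prop. 2.3.1 (2)] -/
theorem IsSatakeSelfTwist.exists_pow_eq_one {π : AutomorphicRepData (AutomorphyDatum.gl n F hF)}
    (h : IsSatakeSelfTwist π) :
    ∃ δ : GaloisRepresentations.HeckeCharacter F, δ ≠ 1 ∧ δ ^ n = 1 ∧ IsSatakeTwistBy π π δ := by
  obtain ⟨δ, hδ1, hδ⟩ := h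
  exact ⟨δ, hδ1, hδ.pow_eq_one_of_self, hδ⟩

end Clauses

/-! ### Thm. 4.1.2 with its two clauses, granting the named fact -/

section Corollaries

variable {F : Type} [Field F] [NumberField F]

/-- **Thm. 4.1.2 with its uniqueness clause**, granting `Ramakrishnan2000_multiplicityOneSL2`: if
the cuspidal `π, π'` on `GL(2)/F` satisfy `(LL)` (a.e., the Satake parameter of `π'` at `v` is
`c_v t_{π,v}`, `c_v ≠ 0`) and `π` admits no non-trivial self-twist ("`π` is not automorphically
induced by a character of a quadratic extension"), then there is a **unique** Hecke character `χ`
with `t_{π',v} = χ(ϖ_v) t_{π,v}` almost everywhere. [cite: Ramakrishnan2000, Theorem 4.1.2] -/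
theorem Ramakrishnan2000_multiplicityOneSL2.existsUnique (h : Ramakrishnan2000_multiplicityOneSL2)
    (h2 : isCompact_glFiniteIntegralLevel 2 F) (π π' : CuspidalAutomorphicRepData 2 F h2)
    (hLL : ∀ᶠ v : HeightOneSpectrum (𝓞 F) in Filter.cofinite, ∃ (α : Multiset ℂ) (c : ℂ), c ≠ 0 ∧
      π.1.HasSatakeParamAt v α ∧ π'.1.HasSatakeParamAt v (α.map (c * ·)))
    (hπ : ¬ IsSatakeSelfTwist π.1) :
    ∃! χ : GaloisRepresentations.HeckeCharacter F, IsSatakeTwistBy π.1 π'.1 χ := by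
  obtain ⟨χ, hχ⟩ := h F h2 π π' hLL
  exact ⟨χ, hχ, fun χ' hχ' => hχ'.unique_of_not_isSatakeSelfTwist hπ hχ⟩

/-- **Thm. 4.1.2 with its quadratic clause**, granting `Ramakrishnan2000_multiplicityOneSL2`: if the
cuspidal `π, π'` on `GL(2)/F` satisfy `(LL)` and have the same central character at the level of
Satake parameters (`det t_{π,v} = det t_{π',v}` a.e.), then some **quadratic** Hecke character `χ`
(`χ ^ 2 = 1`) satisfies `t_{π',v} = χ(ϖ_v) t_{π,v}` almost everywhere ("If `π` and `π'` have the
same central character, then `χ` is quadratic"). [cite: Ramakrishnan2000, Theorem 4.1.2] -/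
theorem Ramakrishnan2000_multiplicityOneSL2.quadratic (h : Ramakrishnan2000_multiplicityOneSL2)
    (h2 : isCompact_glFiniteIntegralLevel 2 F) (π π' : CuspidalAutomorphicRepData 2 F h2)
    (hLL : ∀ᶠ v : HeightOneSpectrum (𝓞 F) in Filter.cofinite, ∃ (α : Multiset ℂ) (c : ℂ), c ≠ 0 ∧
      π.1.HasSatakeParamAt v α ∧ π'.1.HasSatakeParamAt v (α.map (c * ·)))
    (hω : ∀ᶠ v : HeightOneSpectrum (𝓞 F) in Filter.cofinite, ∀ α β : Multiset ℂ,
      π.1.HasSatakeParamAt v α → π'.1.HasSatakeParamAt v β → α.prod = β.prod) :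
    ∃ χ : GaloisRepresentations.HeckeCharacter F, χ ^ 2 = 1 ∧ IsSatakeTwistBy π.1 π'.1 χ := by
  obtain ⟨χ, hχ⟩ := h F h2 π π' hLL
  exact ⟨χ, hχ.pow_eq_one_of_eventually_prod_eq hω, hχ⟩

end Corollaries

end Literature.NumberTheory.Automorphic

end
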